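/-
Copyright (c) 2026 the pub-hodgecm-mathlib formalisation cell (harness21).  Prover seat hodgecm-mathlib-K2Liu-p02 (g4), Track B «K2-LIT» ∕
hLiu418 #184♮, socket #42N «MODEL IDENTIFICATION» of the #42R road, FILE (P3b) of road (N″): the model identification IN D8's CURRENCY
(LEAD F0P6-plan (g11) rulings «M-155k» (9), «M-155m» (2)), 2026-09-04.
-/
import Summits.HodgeConjecture.HodgeConjecture.Theorems.K2LiuUndoublingSeesawAssembly
import Literature.NumberTheory.K2Lit.DoubledLineThetaKernel
import Literature.NumberTheory.Automorphic.Liu2021.Def411WeilCarriersDoublingSeesawLine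

/-!
# Crux `HLiu418`, road `K2_Liu`, socket #42N — FILE (P3b): D8's splitting `chiSplittingLine` at `(𝔻, ⟨a′⟩)`, read on `H(𝔸) = U(𝔻)(𝔸)` along
# `toDiagA`, IS the doubled Weil representation of the datum `(e₀, t₀, ⟨a′⟩)` — the model identification in the leaf's own currency

Cell `hodgecm-mathlib`, crux item hLiu418 = `stmt-HodgeConjecture-24832`; squad K2 ∕ K2Liu, prover K2Liu-p02 (g4), steward lineage of socket #42R.
THEOREMS ONLY (no `def` ∕ instance ∕ notation ∕ named-fact hypothesis ∕ `sorry`); lane `--supports stmt-HodgeConjecture-24832 --as helper`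
(count-neutral).  Instantiation of ★ (P3) `K2LiuUndoublingSeesawAssembly.omega_chiSplitting_adelicInl` at the frame of the DEFS leaf ★ D8
`K2Lit.DoubledLineThetaKernel`: the doubled space `𝔻 = 𝕍 ⊕ (−𝕍)` of the datum `(e, dV, dW)` with its diagonal coefficients
`dD = (t₀ ⊕ (−t₀)) ∘ e₂⁻¹` (★ `dD`), the line `⟨a′⟩` (★ `TW`, `JW`, `lineW`), the transport ★ `toDiagA : H(𝔸) ≃* U(diagonal dD)(𝔸)`.

* `dD_natAdd_eq_neg` — «the second block is `−t₀`»: `dD (natAdd i) = −dD (castAdd i)` (the hypothesis `hBA` of (P3));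
* `coe_mem_HA_prodUnique` — `H(𝔸) = U(𝔻)(𝔸)` IS the adelic group of the doubled datum `(e₀, t₀, ⟨a′⟩)`, `e₀ = Equiv.prodUnique`,
  `t₀ = dD ∘ castAdd` (★ `HA_e₀_eq_adelic` + ★ `adelic_hermD_eq`);
* **`omega_chiSplittingLine_adelicInl_toDiagA`** — for `h ∈ H(𝔸)` and every `Ψ ∈ 𝒮(𝔸^{n+n})`:
  `ω(chiSplittingLine χ a′ (toDiagA h ⊗ 1)) (R_r Ψ) = R_r (ω(doubledWeilRep χ (e₀, t₀, ⟨a′⟩) h) Ψ)`, `R_r` the row relabelling along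
  `rowEquiv e₁ : Fin (n+n) ≃ Fin n″` — D8's model (ii) on `U(𝔻)` = model (i), EXACTLY (★ `omega_splittingCongr_apply` peels `chiSplittingLine`
  to `chiSplitting` at `dW := lineW (TW a′)`).

HONEST LABEL.  Count-neutral helper; it pays nothing by itself: `HC_CM` is proved only modulo the 7 printed citations (2 remaining named inputs:
hLiu418 = `stmt-HodgeConjecture-24832`, h413 = `stmt-HodgeConjecture-24833`) until rung 0 closes; socket #42N is not yet typed (U6 ED. 10).
References: [HarrisKudlaSweet1996] §1 (1.14)–(1.15), Cor. A.3; [Kudla1994] §2, Thm. 3.1; [Liu2021] App. B (B.7) p. 104, App. D Step 2;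
[GelbartRogawski1991] §3.1 Prop. 3.1.1 p. 455; [Kudla1984] §1.
-/

set_option autoImplicit false
-- the mandated namespace repeats the single-problem summit's segment (`HodgeConjecture.HodgeConjecture`)
set_option linter.dupNamespace false

noncomputable section

open scoped Classical Matrix
open NumberField IsDedekindDomain
open Literature.RepresentationTheory.HeisenbergGroup
open Literature.NumberTheory.Automorphic hiding permGL coe_permGL
open Literature.NumberTheory.Weil1964 Literature.RepresentationTheory.HarrisKudlaSweet1996 Literature.NumberTheory.GaloisRepresentations
open Literature.NumberTheory.GelbartRogawski1991 Literature.NumberTheory.GelbartRogawski1991.UnitaryDualPair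
open Literature.NumberTheory.GelbartRogawski1991.GRConstruction
open Literature.NumberTheory.Automorphic.Liu2021 Literature.NumberTheory.Automorphic.Liu2021.Def411WeilCarriers
open Literature.NumberTheory.Automorphic.Liu2021.Def411WeilCarriersDoubling
open Literature.NumberTheory.K2Lit.DoubledLineTheta
open Summit.HodgeConjecture.HodgeConjecture.Cruxes.HLiu418.K2LiuUndoublingSeesawPermutation
open Summit.HodgeConjecture.HodgeConjecture.Cruxes.HLiu418.K2LiuUndoublingSeesawPermutationMem
open Summit.HodgeConjecture.HodgeConjecture.Cruxes.HLiu418.K2LiuUndoublingSeesawAssembly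

namespace Summit.HodgeConjecture.HodgeConjecture.Cruxes.HLiu418.K2LiuUndoublingSeesawLine

variable (L : Type) [Field L] [NumberField L] [IsCMField L]
variable {N M n : ℕ} (e : Fin N × Fin M ≃ Fin n)
  (dV : Fin N → L) (hdV : ∀ i, IsCMField.complexConj L (dV i) = dV i) (hdV0 : ∀ i, dV i ≠ 0)
  (dW : Fin M → L) (hdW : ∀ i, IsCMField.complexConj L (dW i) = dW i) (hdW0 : ∀ i, dW i ≠ 0)
  {n'' : ℕ} (e₁ : Fin (n + n) × Fin 1 ≃ Fin n'') (a' : (↥(maximalRealSubfield L))ˣ)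
  (χ : HeckeCharacter L) (hχu : χ.IsUnitary) (hχs : IsSplittingChar L 1 χ)

/-- **the second block of `dD` is `−t₀`**: `dD (natAdd i) = −dD (castAdd i)` (`dD = (t₀ ⊕ (−t₀)) ∘ e₂⁻¹`, `e₂ (inl i) = castAdd i`,
`e₂ (inr i) = natAdd i`) — the hypothesis `hBA` («`V₂ = −V₁`») of ★ (P3) at D8's frame. [cite: GelbartRogawski1991, §3.1 Prop. 3.1.1 p. 455] -/
theorem dD_natAdd_eq_neg (i : Fin n) :
    dD L e dV hdV dW hdW (Fin.natAdd n i) = -dD L e dV hdV dW hdW (Fin.castAdd n i) := by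
  unfold dD
  rw [← finSumFinEquiv_apply_right, ← finSumFinEquiv_apply_left, Equiv.symm_apply_apply, Equiv.symm_apply_apply, Sum.elim_inr,
    Sum.elim_inl, Pi.neg_apply, NegMemClass.coe_neg]

omit [Field L] [NumberField L] [IsCMField L] in
/-- the enumeration `e₀ = Equiv.prodUnique (Fin n) (Fin 1)` has `e₀⁻¹ m = (m, 0)`. [cite: Kudla1984, §1] -/
theorem prodUnique_symm_fst (m : Fin n) : ((Equiv.prodUnique (Fin n) (Fin 1)).symm m).1 = m := by
  rw [Equiv.prodUnique_symm_apply]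

/-- **`H(𝔸) = U(𝔻)(𝔸)` is the adelic group of the doubled datum `(e₀, t₀, ⟨a′⟩)`**: the matrix of every `h ∈ H(𝔸)` lies in the doubled
group of `(Equiv.prodUnique, dD ∘ castAdd, lineW (TW a′))` (★ `HA_e₀_eq_adelic` + ★ `adelic_hermD_eq`).
[cite: GelbartRogawski1991, §3.1 Prop. 3.1.1 p. 455] [cite: Kudla1994, §2 (doubled space, Siegel parabolic)] -/
theorem coe_mem_HA_prodUnique (h : HA L e dV hdV dW hdW) :
    (h : GL (Fin (n + n)) (AdeleRing (𝓞 L) L)) ∈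
      HA L (Equiv.prodUnique (Fin n) (Fin 1)) (fun i => dD L e dV hdV dW hdW (Fin.castAdd n i))
        (fun i => dD_conj L e dV hdV dW hdW (Fin.castAdd n i)) (lineW L (TW (Fp L) a')) (complexConj_lineW L (TW (Fp L) a')) := by
  rw [HA_e₀_eq_adelic L (Equiv.prodUnique (Fin n) (Fin 1)) (prodUnique_symm_fst) (dD L e dV hdV dW hdW)
    (dD_natAdd_eq_neg L e dV hdV dW hdW) (lineW L (TW (Fp L) a')) (complexConj_lineW L (TW (Fp L) a'))
    (fun i => dD L e dV hdV dW hdW (Fin.castAdd n i)) (fun i => dD_conj L e dV hdV dW hdW (Fin.castAdd n i)) (fun _ => rfl)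
    (lineW_ne_zero L (TW (Fp L) a') (isUnit_det_TW (Fp L) a') 0), ← adelic_hermD_eq L e dV hdV dW hdW]
  exact h.2

include hdV0 hdW0 in
/-- **D8's MODEL (ii) ON `U(𝔻)` = MODEL (i), in the leaf's currency.**  For `h ∈ H(𝔸) = U(𝔻)(𝔸)`, `h₁` the same matrix read in the
doubled group of `(e₀, t₀, ⟨a′⟩)`, and every `Ψ ∈ 𝒮(𝔸^{n+n})`:
`ω(chiSplittingLine χ ⟨a′⟩ (toDiagA h ⊗ 1)) (R_r Ψ) = R_r (ω(doubledWeilRep χ (e₀, t₀, ⟨a′⟩) h₁) Ψ)` — the Weil operators through which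
★ `doubledLineThetaLift` reads `U(𝔻)` are, up to the row relabelling `R_r` (`r = rowEquiv e₁`), those of the doubled Weil representation of the
hermitian space `𝕍 ⊗ W` (frame `t₀ = dD ∘ castAdd`) against the line `⟨a′⟩`.  No twist, no generation hypothesis.
[cite: HarrisKudlaSweet1996, §1 (1.14)–(1.15), Cor. A.3 p. 998] [cite: Kudla1994, §2 (doubled space, Siegel parabolic), Thm. 3.1]
[cite: Liu2021, App. B (B.7) p. 104, App. D §D.1 Step 2] [cite: Kudla1984, §1] -/
theorem omega_chiSplittingLine_adelicInl_toDiagA (h : HA L e dV hdV dW hdW)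
    (h₁ : HA L (Equiv.prodUnique (Fin n) (Fin 1)) (fun i => dD L e dV hdV dW hdW (Fin.castAdd n i))
      (fun i => dD_conj L e dV hdV dW hdW (Fin.castAdd n i)) (lineW L (TW (Fp L) a')) (complexConj_lineW L (TW (Fp L) a')))
    (hh₁ : (h₁ : GL (Fin (n + n)) (AdeleRing (𝓞 L) L)) = (h : GL (Fin (n + n)) (AdeleRing (𝓞 L) L)))
    (Ψ : piSchwartzBruhat (Fp L) (Fin (n + n))) :
    adelicMpCont.omega (Fp L) (Fin n'')
        (adelicGram (Fp L) e₁ (realDiagonal L (dD L e dV hdV dW hdW) (dD_conj L e dV hdV dW hdW)) (TW (Fp L) a'))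
        (chiSplittingLine L e₁ (dD L e dV hdV dW hdW) (dD_conj L e dV hdV dW hdW) (dD_ne_zero L e dV hdV dW hdW hdV0 hdW0) χ hχu hχs
          (TW (Fp L) a') (isUnit_det_TW (Fp L) a') (JW (Fp L) L a') (JW_eq (Fp L) L a')
          (UnitaryGroup.adelicInl (Fp L) L (IsCMField.complexConj L) (n + n) 1 (Matrix.diagonal (dD L e dV hdV dW hdW)) (JW (Fp L) L a')
            (toDiagA L e dV hdV dW hdW h)))
        (piSBReindex (Fp L) (rowEquiv e₁) Ψ) =
      piSBReindex (Fp L) (rowEquiv e₁)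
        (adelicMpCont.omega (Fp L) (Fin (n + n))
          (gramDA L (Equiv.prodUnique (Fin n) (Fin 1)) (fun i => dD L e dV hdV dW hdW (Fin.castAdd n i))
            (fun i => dD_conj L e dV hdV dW hdW (Fin.castAdd n i)) (lineW L (TW (Fp L) a')) (complexConj_lineW L (TW (Fp L) a')))
          (doubledWeilRep L (Equiv.prodUnique (Fin n) (Fin 1)) (fun i => dD L e dV hdV dW hdW (Fin.castAdd n i))
            (fun i => dD_conj L e dV hdV dW hdW (Fin.castAdd n i)) (fun i => dD_ne_zero L e dV hdV dW hdW hdV0 hdW0 (Fin.castAdd n i))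
            (lineW L (TW (Fp L) a')) (complexConj_lineW L (TW (Fp L) a'))
            (lineW_ne_zero L (TW (Fp L) a') (isUnit_det_TW (Fp L) a')) χ hχu hχs h₁) Ψ) := by
  -- peel `chiSplittingLine = splittingCongr … (chiSplitting … (lineW (TW a′)) …)` (a cast along `T_W = realDiagonal (lineW T_W)`)
  have key := omega_splittingCongr_apply (Fp L) L (IsCMField.complexConj L) (n + n) 1 e₁ (Matrix.diagonal (dD L e dV hdV dW hdW))
    (realDiagonal_lineW L (TW (Fp L) a')) (diagonal_lineW L (TW (Fp L) a') (JW_eq (Fp L) L a'))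
    (chiSplitting L e₁ (dD L e dV hdV dW hdW) (dD_conj L e dV hdV dW hdW) (dD_ne_zero L e dV hdV dW hdW hdV0 hdW0)
      (lineW L (TW (Fp L) a')) (complexConj_lineW L (TW (Fp L) a')) (lineW_ne_zero L (TW (Fp L) a') (isUnit_det_TW (Fp L) a')) χ hχu hχs)
    (UnitaryGroup.adelicInl (Fp L) L (IsCMField.complexConj L) (n + n) 1 (Matrix.diagonal (dD L e dV hdV dW hdW)) (JW (Fp L) L a')
      (toDiagA L e dV hdV dW hdW h))
    (piSBReindex (Fp L) (rowEquiv e₁) Ψ)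
  -- the retyped pair element IS `adelicInl (toDiagA h)` over `diagonal (lineW (TW a′))` (same matrix `x ⊗ 1`)
  have hx : (⟨((UnitaryGroup.adelicInl (Fp L) L (IsCMField.complexConj L) (n + n) 1 (Matrix.diagonal (dD L e dV hdV dW hdW)) (JW (Fp L) L a')
        (toDiagA L e dV hdV dW hdW h) : UnitaryGroup.adelicPair (Fp L) L (IsCMField.complexConj L) (n + n) 1
          (Matrix.diagonal (dD L e dV hdV dW hdW)) (JW (Fp L) L a')) : GL (Fin (n + n) × Fin 1) (AdeleRing (𝓞 L) L)),
        mem_adelicPair_of_eq (Fp L) L (IsCMField.complexConj L) (n + n) 1 rfl (diagonal_lineW L (TW (Fp L) a') (JW_eq (Fp L) L a')).symm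
          (UnitaryGroup.adelicInl (Fp L) L (IsCMField.complexConj L) (n + n) 1 (Matrix.diagonal (dD L e dV hdV dW hdW)) (JW (Fp L) L a')
            (toDiagA L e dV hdV dW hdW h)).2⟩ :
        UnitaryGroup.adelicPair (Fp L) L (IsCMField.complexConj L) (n + n) 1 (Matrix.diagonal (dD L e dV hdV dW hdW))
          (Matrix.diagonal (lineW L (TW (Fp L) a')))) =
      UnitaryGroup.adelicInl (Fp L) L (IsCMField.complexConj L) (n + n) 1 (Matrix.diagonal (dD L e dV hdV dW hdW))
        (Matrix.diagonal (lineW L (TW (Fp L) a'))) (toDiagA L e dV hdV dW hdW h) :=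
    -- (both matrices are `x ⊗ₖ 1` by the ★ rfl-lemma `coe_adelicInl`; spelled out so that the kernel never compares `J_W` with
    -- `diagonal (lineW T_W)` under the coercions)
    Subtype.ext (Units.ext
      ((UnitaryGroup.coe_adelicInl (Fp L) L (IsCMField.complexConj L) (n + n) 1 (Matrix.diagonal (dD L e dV hdV dW hdW))
          (JW (Fp L) L a') (toDiagA L e dV hdV dW hdW h)).trans
        (UnitaryGroup.coe_adelicInl (Fp L) L (IsCMField.complexConj L) (n + n) 1 (Matrix.diagonal (dD L e dV hdV dW hdW))
          (Matrix.diagonal (lineW L (TW (Fp L) a'))) (toDiagA L e dV hdV dW hdW h)).symm))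
  unfold chiSplittingLine
  refine key.trans ?_
  refine (congrArg (fun y => adelicMpCont.omega (Fp L) (Fin n'')
    (gramA L e₁ (dD L e dV hdV dW hdW) (dD_conj L e dV hdV dW hdW) (lineW L (TW (Fp L) a')) (complexConj_lineW L (TW (Fp L) a')))
    (chiSplitting L e₁ (dD L e dV hdV dW hdW) (dD_conj L e dV hdV dW hdW) (dD_ne_zero L e dV hdV dW hdW hdV0 hdW0)
      (lineW L (TW (Fp L) a')) (complexConj_lineW L (TW (Fp L) a')) (lineW_ne_zero L (TW (Fp L) a') (isUnit_det_TW (Fp L) a')) χ hχu hχs y)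
    (piSBReindex (Fp L) (rowEquiv e₁) Ψ)) hx).trans ?_
  exact omega_chiSplitting_adelicInl L e₁ (Equiv.prodUnique (Fin n) (Fin 1)) (prodUnique_symm_fst)
    (fun i => dD L e dV hdV dW hdW (Fin.castAdd n i)) (fun i => dD_conj L e dV hdV dW hdW (Fin.castAdd n i))
    (fun i => dD_ne_zero L e dV hdV dW hdW hdV0 hdW0 (Fin.castAdd n i)) (fun i => dD L e dV hdV dW hdW (Fin.natAdd n i))
    (fun i => dD_conj L e dV hdV dW hdW (Fin.natAdd n i)) (dD L e dV hdV dW hdW) (dD_conj L e dV hdV dW hdW)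
    (dD_ne_zero L e dV hdV dW hdW hdV0 hdW0) (fun _ => rfl) (fun _ => rfl) (dD_natAdd_eq_neg L e dV hdV dW hdW)
    (lineW L (TW (Fp L) a')) (complexConj_lineW L (TW (Fp L) a'))
    (lineW_ne_zero L (TW (Fp L) a') (isUnit_det_TW (Fp L) a')) χ hχu hχs (toDiagA L e dV hdV dW hdW h) h₁
    (hh₁.trans (coe_toDiagA L e dV hdV dW hdW h).symm) Ψ

include hdV0 hdW0 in
/-- the same with the canonical `h₁ := h` read in the doubled group of `(e₀, t₀, ⟨a′⟩)` (`coe_mem_HA_prodUnique`).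
[cite: HarrisKudlaSweet1996, §1 (1.14)–(1.15), Cor. A.3 p. 998] [cite: Kudla1994, §2 (doubled space, Siegel parabolic), Thm. 3.1] -/
theorem omega_chiSplittingLine_adelicInl_toDiagA' (h : HA L e dV hdV dW hdW) (Ψ : piSchwartzBruhat (Fp L) (Fin (n + n))) :
    adelicMpCont.omega (Fp L) (Fin n'')
        (adelicGram (Fp L) e₁ (realDiagonal L (dD L e dV hdV dW hdW) (dD_conj L e dV hdV dW hdW)) (TW (Fp L) a'))
        (chiSplittingLine L e₁ (dD L e dV hdV dW hdW) (dD_conj L e dV hdV dW hdW) (dD_ne_zero L e dV hdV dW hdW hdV0 hdW0) χ hχu hχs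
          (TW (Fp L) a') (isUnit_det_TW (Fp L) a') (JW (Fp L) L a') (JW_eq (Fp L) L a')
          (UnitaryGroup.adelicInl (Fp L) L (IsCMField.complexConj L) (n + n) 1 (Matrix.diagonal (dD L e dV hdV dW hdW)) (JW (Fp L) L a')
            (toDiagA L e dV hdV dW hdW h)))
        (piSBReindex (Fp L) (rowEquiv e₁) Ψ) =
      piSBReindex (Fp L) (rowEquiv e₁)
        (adelicMpCont.omega (Fp L) (Fin (n + n))
          (gramDA L (Equiv.prodUnique (Fin n) (Fin 1)) (fun i => dD L e dV hdV dW hdW (Fin.castAdd n i))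
            (fun i => dD_conj L e dV hdV dW hdW (Fin.castAdd n i)) (lineW L (TW (Fp L) a')) (complexConj_lineW L (TW (Fp L) a')))
          (doubledWeilRep L (Equiv.prodUnique (Fin n) (Fin 1)) (fun i => dD L e dV hdV dW hdW (Fin.castAdd n i))
            (fun i => dD_conj L e dV hdV dW hdW (Fin.castAdd n i)) (fun i => dD_ne_zero L e dV hdV dW hdW hdV0 hdW0 (Fin.castAdd n i))
            (lineW L (TW (Fp L) a')) (complexConj_lineW L (TW (Fp L) a'))
            (lineW_ne_zero L (TW (Fp L) a') (isUnit_det_TW (Fp L) a')) χ hχu hχs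
            ⟨(h : GL (Fin (n + n)) (AdeleRing (𝓞 L) L)), coe_mem_HA_prodUnique L e dV hdV dW hdW a' h⟩) Ψ) :=
  omega_chiSplittingLine_adelicInl_toDiagA L e dV hdV hdV0 dW hdW hdW0 e₁ a' χ hχu hχs h
    ⟨(h : GL (Fin (n + n)) (AdeleRing (𝓞 L) L)), coe_mem_HA_prodUnique L e dV hdV dW hdW a' h⟩ rfl Ψ

end Summit.HodgeConjecture.HodgeConjecture.Cruxes.HLiu418.K2LiuUndoublingSeesawLine

end
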